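import Literature.NumberTheory.Automorphic.AdelicVectorPlaceSplitting
import Literature.NumberTheory.Automorphic.AdelicPiSchwartzBruhatDensity
import Literature.NumberTheory.Automorphic.FiniteAdeleSchwartzBruhatFourier
import Literature.NumberTheory.Automorphic.AdelicSchwartzBruhatCosetSums
import HarnessLib

/-!
# Schwartz–Bruhat functions on `X(𝔸_K) = X(K_v) × X(𝔸_K)^{(v)}`: the finite decomposition
# `Φ(a, y) = Σ_t 𝟙_{t + U}(a) · Φ(t, y)` into pure tensors at ONE finite place

Topic `NumberTheory/Automorphic`; namespace `Literature.NumberTheory.Automorphic.AdelicVector`.  THEOREMS ONLY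
(no definition, no instance, no notation, no named fact, no `sorry`).

For a number field `K`, a finite index type `ι` and a finite place `v`, ★ `AdelicVectorPlaceSplitting` splits the
adelic vector space `X(𝔸_K) = ι → 𝔸_K` as `placeSplitting K ι v : X(K_v) × trivialAt K ι v ≃ₜ+ X(𝔸_K)`,
`(a, y) ↦ single a + y`.  A Schwartz–Bruhat function `Φ ∈ 𝒮(X(𝔸_K)) = piSchwartzBruhat K ι` (the span of
`Φ_∞ ⊗ Φ_f`, `Φ_f` locally constant of compact support on `(𝔸_K^∞)^ι`) is a «standard function» in Weil's
sense: through the splitting it is a FINITE SUM OF PURE TENSORS `𝟙_{t + U} ⊗ φ_t` with `U` a compact open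
subgroup of `X(K_v)`, `t` running over finitely many pairwise inequivalent representatives, and
`φ_t = Φ(single t + ·)` the SLICE of `Φ` at `t` ([WeilBNT1967] Ch. VII §2, Def. 1 and the remarks after it:
a standard function on `E_A = E_v × E'` is a finite linear combination of `𝟙_{coset} ⊗ (standard on E')`;
[Weil1965] Chap. V n° 50, p. 74: `X_A = X_v × X'`, "toute fonction standard sur `X_A` est combinaison linéaire finie
de fonctions `φ_v ⊗ φ'`"; [Bump1997] §3.3, Prop. 3.3.2 for `𝔸 = F_v × 𝔸^v`).

* §1 `exists_level_at` — a LEVEL AT `v`: a compact open subgroup `U ≤ X(K_v)` with `Φ(x + single c) = Φ(x)`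
  for all `x` and `c ∈ U` (★ `exists_level_of_mem_schwartzBruhat` for the finite factor, span induction);
* §2 `exists_isCompact_evalAt_mem` — the `v`-components of the support of `Φ` lie in a compact set;
* §3 `eq_sum_indicator_mul_of_level` (pure algebra: level + compact `v`-support + inequivalent representatives
  covering it ⇒ the sum formula) and the decomposition theorems **`exists_sum_indicator_mul_slice`** (complex)
  and **`exists_sum_indicator_mul_slice_real`** (`Ψ ∈ piSchwartzBruhatReal K ι`, ★ `AdelicPiSchwartzBruhatDensity`):
  `Φ (placeSplitting (a, y)) = Σ_{t ∈ T} 𝟙_{t + U}(a) · Φ (placeSplitting (t, y))`;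
* sequel ★ `AdelicVectorPlaceSplittingSchwartzBruhatSlices`: the slices `𝟙_A(x_v) · Φ(single t + x^{(v)})` are again
  in `𝒮(X(𝔸_K))`, inherit compact support / sign, and the integrated form `∫ Ψ dν = Σ_t ∫ 𝟙_{t+U} ⊗ Ψ(t, ·) dν`.

USE (cell `hodgecm-mathlib`, P4 ENGINE E-2, child line `Cruxes/H413/Lines/F0_E2SiegelWeilWeilRange.lean`, stub
`stub_SW2_siegelWeil` (iii), identity road (W), ruling «TENS-v»): with the `Y`-free I-CLOSE core
(★ `Theorems/H413E2SWIdentityCloseCoreMarginal.measure_eq_smul_of_dilate_bound`, one identity of `φ_t`-weighted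
`X(K_v)`-marginals per slice) and linearity of the integral this gives `∫ Ψ dμ̂_b = κ₀ ∫ Ψ dμ_b` for every
`Ψ ∈ 𝒮_ℝ(X(𝔸_K))`.  HC_CM is proved only modulo the printed citations until rung 0 closes — nothing here bears on
a summit statement.

## References
* [WeilBNT1967] A. Weil, *Basic Number Theory* (1967), Ch. VII §2 (standard functions), Def. 1, Prop. 2.
* [Weil1965] A. Weil, *Sur la formule de Siegel dans la théorie des groupes classiques*, Acta Math. 113 (1965),
  Chap. V n° 50 (proof of Thm. 4), p. 74.
* [Bump1997] D. Bump, *Automorphic Forms and Representations* (1997), §3.3, Prop. 3.3.2.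
-/

set_option autoImplicit false

noncomputable section

open MeasureTheory Set Filter Topology IsDedekindDomain NumberField
open scoped Pointwise

namespace Literature.NumberTheory.Automorphic

namespace AdelicVector

variable {K : Type} [Field K] [NumberField K] {ι : Type} [Fintype ι] {v : HeightOneSpectrum (𝓞 K)}

/-! ## §0 Small identities along the splitting -/

omit [Fintype ι] in
/-- `single` has no archimedean component: `piArch (single a) = 0`. [cite: Bump1997, §3.3 Prop. 3.3.2] -/
theorem piArch_single (a : ι → v.adicCompletion K) : piArch K ι (single K ι v a) = 0 := by
  funext i
  rw [piArch_apply, fst_single_apply, map_zero, Pi.zero_apply]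

omit [Fintype ι] in
/-- `evalAt (placeSplitting (a, y)) = a`. [cite: Bump1997, §3.3 Prop. 3.3.2] -/
theorem evalAt_placeSplitting (p : (ι → v.adicCompletion K) × trivialAt K ι v) :
    evalAt K ι v (placeSplitting K ι v p) = p.1 := by
  rw [← placeSplitting_symm_apply_fst, ContinuousAddEquiv.symm_apply_apply]

omit [Fintype ι] in
/-- `placeSplitting (a + c, y) = placeSplitting (a, y) + single c`. [cite: Bump1997, §3.3 Prop. 3.3.2] -/
theorem placeSplitting_add_fst (a c : ι → v.adicCompletion K) (y : trivialAt K ι v) :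
    placeSplitting K ι v (a + c, y) = placeSplitting K ι v (a, y) + single K ι v c := by
  simp only [placeSplitting_apply, map_add]
  abel

omit [Fintype ι] in
/-- `placeSplitting (t, (placeSplitting⁻¹ x).2) = single t + (x − single x_v)`: the slice point over `t` with the
same prime-to-`v` part as `x`. [cite: Bump1997, §3.3 Prop. 3.3.2] -/
theorem placeSplitting_mk_symm_snd (t : ι → v.adicCompletion K) (x : ι → AdeleRing (𝓞 K) K) :
    placeSplitting K ι v (t, ((placeSplitting K ι v).symm x).2) =
      single K ι v t + (x - single K ι v (evalAt K ι v x)) := by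
  rw [placeSplitting_apply, placeSplitting_symm_apply_snd]

omit [Fintype ι] in
/-- The `v`-components read on the finite part: `evalAt x = (piFinite x · v)`, written through `piAdeleSplit`.
[cite: Bump1997, §3.3 Prop. 3.3.2] -/
theorem evalAt_eq_evalAt_piAdeleSplit_piFinite (x : ι → AdeleRing (𝓞 K) K) :
    evalAt K ι v x = evalAt K ι v (piAdeleSplit K ι (0, piFinite K ι x)) := by
  funext i
  rfl

/-! ## §1 A level at `v` -/

/-- **A Schwartz–Bruhat function on `X(𝔸_K)` has a level at `v`**: there is a compact open subgroup `U` of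
`X(K_v)` with `Φ(x + single c) = Φ(x)` for all `x ∈ X(𝔸_K)`, `c ∈ U` (for a tensor `Φ_∞ ⊗ Φ_f` take the preimage
under `c ↦ (single c)_f` of a level `(𝔫𝒪̂_K)^ι` of `Φ_f`, ★ `exists_level_of_mem_schwartzBruhat`, cut down to
`𝒪_v^ι`; sums and scalar multiples: intersect). [cite: WeilBNT1967, Ch. VII §2 Def. 1] -/
theorem exists_level_at (v : HeightOneSpectrum (𝓞 K)) {Φ : (ι → AdeleRing (𝓞 K) K) → ℂ}
    (hΦ : Φ ∈ piSchwartzBruhat K ι) :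
    ∃ U : AddSubgroup (ι → v.adicCompletion K), IsOpen (U : Set (ι → v.adicCompletion K)) ∧
      IsCompact (U : Set (ι → v.adicCompletion K)) ∧ ∀ x, ∀ c ∈ U, Φ (x + single K ι v c) = Φ x := by
  classical
  -- an OPEN level first, by span induction
  have hopen : ∃ U : AddSubgroup (ι → v.adicCompletion K), IsOpen (U : Set (ι → v.adicCompletion K)) ∧
      ∀ x, ∀ c ∈ U, Φ (x + single K ι v c) = Φ x := by
    induction hΦ using Submodule.span_induction with
    | mem Φ hΦ =>
      obtain ⟨Φinf, Φfin, hfin, rfl⟩ := hΦ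
      obtain ⟨𝔫, -, hlev⟩ := exists_level_of_mem_schwartzBruhat K hfin
      -- `c ↦ (single c)_f` as an additive homomorphism `X(K_v) →+ (𝔸_K^∞)^ι`
      let σ : (ι → v.adicCompletion K) →+ (ι → FiniteAdeleRing (𝓞 K) K) :=
        { toFun := fun c => piFinite K ι (single K ι v c)
          map_zero' := by rw [map_zero]; rfl
          map_add' := fun c c' => by rw [map_add, piFinite_add] }
      have hσ : Continuous σ := (continuous_piFinite (K := K) (ι := ι)).comp (continuous_single K ι v)
      refine ⟨(piLevelIdeal K ι 𝔫).comap σ, (isOpen_piLevelIdeal K 𝔫).preimage hσ, fun x c hc => ?_⟩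
      have h1 : piArch K ι (x + single K ι v c) = piArch K ι x := by
        rw [piArch_add, piArch_single, add_zero]
      have h2 : piFinite K ι (x + single K ι v c) = piFinite K ι x + σ c := by
        rw [piFinite_add]; rfl
      simp only [h1, h2, hlev _ _ (AddSubgroup.mem_comap.1 hc)]
    | zero => exact ⟨⊤, by rw [AddSubgroup.coe_top]; exact isOpen_univ, fun _ _ _ => rfl⟩
    | add Φ₁ Φ₂ _ _ h₁ h₂ =>
      obtain ⟨U₁, hU₁, h₁⟩ := h₁
      obtain ⟨U₂, hU₂, h₂⟩ := h₂
      refine ⟨U₁ ⊓ U₂, ?_, fun x c hc => ?_⟩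
      · rw [AddSubgroup.coe_inf]; exact hU₁.inter hU₂
      · rw [AddSubgroup.mem_inf] at hc
        simp only [Pi.add_apply, h₁ x c hc.1, h₂ x c hc.2]
    | smul a Φ _ h =>
      obtain ⟨U, hU, h⟩ := h
      exact ⟨U, hU, fun x c hc => by simp only [Pi.smul_apply, h x c hc]⟩
  obtain ⟨U₀, hU₀, hlev⟩ := hopen
  -- cut down to the compact open integer box `𝒪_v^ι`
  let W : AddSubgroup (ι → v.adicCompletion K) :=
    AddSubgroup.pi Set.univ fun _ => (v.adicCompletionIntegers K).toSubring.toAddSubgroup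
  have hWset : (W : Set (ι → v.adicCompletion K)) =
      Set.pi Set.univ fun _ => (v.adicCompletionIntegers K : Set (v.adicCompletion K)) := by
    ext c; simp [W, AddSubgroup.mem_pi]
  have hWo : IsOpen (W : Set (ι → v.adicCompletion K)) := by
    rw [hWset]
    exact isOpen_set_pi Set.finite_univ fun _ _ => Valued.isOpen_valuationSubring _
  have hWc : IsCompact (W : Set (ι → v.adicCompletion K)) := by
    rw [hWset]
    haveI := compactSpace_adicCompletionIntegers' K v
    exact isCompact_univ_pi fun _ => isCompact_iff_compactSpace.2 ‹_›
  refine ⟨U₀ ⊓ W, ?_, ?_, fun x c hc => hlev x c (AddSubgroup.mem_inf.1 hc).1⟩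
  · rw [AddSubgroup.coe_inf]; exact hU₀.inter hWo
  · have ho : IsOpen ((U₀ ⊓ W : AddSubgroup _) : Set (ι → v.adicCompletion K)) := by
      rw [AddSubgroup.coe_inf]; exact hU₀.inter hWo
    exact hWc.of_isClosed_subset ((U₀ ⊓ W).isClosed_of_isOpen ho)
      (by rw [AddSubgroup.coe_inf]; exact Set.inter_subset_right)

/-- The level of a REAL Schwartz–Bruhat function. [cite: WeilBNT1967, Ch. VII §2 Def. 1] -/
theorem exists_level_at_real (v : HeightOneSpectrum (𝓞 K)) {Ψ : (ι → AdeleRing (𝓞 K) K) → ℝ}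
    (hΨ : Ψ ∈ piSchwartzBruhatReal K ι) :
    ∃ U : AddSubgroup (ι → v.adicCompletion K), IsOpen (U : Set (ι → v.adicCompletion K)) ∧
      IsCompact (U : Set (ι → v.adicCompletion K)) ∧ ∀ x, ∀ c ∈ U, Ψ (x + single K ι v c) = Ψ x := by
  obtain ⟨U, hUo, hUc, h⟩ := exists_level_at v (mem_piSchwartzBruhatReal_iff.1 hΨ)
  exact ⟨U, hUo, hUc, fun x c hc => Complex.ofReal_injective (h x c hc)⟩

/-! ## §2 The `v`-support is compact -/

/-- **The `v`-components of the support of `Φ ∈ 𝒮(X(𝔸_K))` lie in a compact subset of `X(K_v)`** (for a tensor: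
the image of the compact support of `Φ_f` under the continuous `z ↦ (z_i,v)_i`). [cite: WeilBNT1967, Ch. VII §2 Def. 1] -/
theorem exists_isCompact_evalAt_mem (v : HeightOneSpectrum (𝓞 K)) {Φ : (ι → AdeleRing (𝓞 K) K) → ℂ}
    (hΦ : Φ ∈ piSchwartzBruhat K ι) :
    ∃ C : Set (ι → v.adicCompletion K), IsCompact C ∧ ∀ x, Φ x ≠ 0 → evalAt K ι v x ∈ C := by
  induction hΦ using Submodule.span_induction with
  | mem Φ hΦ =>
    obtain ⟨Φinf, Φfin, hfin, rfl⟩ := hΦ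
    have hE : Continuous fun z : ι → FiniteAdeleRing (𝓞 K) K => evalAt K ι v (piAdeleSplit K ι (0, z)) :=
      (continuous_evalAt K ι v).comp ((piAdeleSplit K ι).continuous.comp (Continuous.prodMk_right 0))
    refine ⟨(fun z => evalAt K ι v (piAdeleSplit K ι (0, z))) '' tsupport Φfin,
      (mem_schwartzBruhat_iff.1 hfin).2.image hE, fun x hx => ?_⟩
    refine ⟨piFinite K ι x, subset_tsupport _ (Function.mem_support.2 (right_ne_zero_of_mul hx)),
      (evalAt_eq_evalAt_piAdeleSplit_piFinite x).symm⟩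
  | zero => exact ⟨∅, isCompact_empty, fun x hx => (hx rfl).elim⟩
  | add Φ₁ Φ₂ _ _ h₁ h₂ =>
    obtain ⟨C₁, hC₁, h₁⟩ := h₁
    obtain ⟨C₂, hC₂, h₂⟩ := h₂
    refine ⟨C₁ ∪ C₂, hC₁.union hC₂, fun x hx => ?_⟩
    by_cases h0 : Φ₁ x = 0
    · rw [Pi.add_apply, h0, zero_add] at hx
      exact Or.inr (h₂ x hx)
    · exact Or.inl (h₁ x h0)
  | smul a Φ _ h =>
    obtain ⟨C, hC, h⟩ := h
    exact ⟨C, hC, fun x hx => h x (right_ne_zero_of_mul hx)⟩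

/-! ## §3 The decomposition into pure tensors -/

omit [Fintype ι] in
/-- **Sum formula from a level** (pure bookkeeping, any coefficients): if `Φ(x + single c) = Φ(x)` for `c ∈ U`,
the `v`-components of the support of `Φ` lie in `C`, and `T` is a set of pairwise `U`-inequivalent
representatives whose cosets cover `C`, then `Φ (placeSplitting (a, y)) = Σ_{t ∈ T} 𝟙_{t + U}(a) · Φ (placeSplitting (t, y))`.
[cite: WeilBNT1967, Ch. VII §2 Def. 1] -/
theorem eq_sum_indicator_mul_of_level {R : Type*} [NonAssocSemiring R] {Φ : (ι → AdeleRing (𝓞 K) K) → R}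
    {U : AddSubgroup (ι → v.adicCompletion K)} (hlev : ∀ x, ∀ c ∈ U, Φ (x + single K ι v c) = Φ x)
    {C : Set (ι → v.adicCompletion K)} (hC : ∀ x, Φ x ≠ 0 → evalAt K ι v x ∈ C)
    {T : Finset (ι → v.adicCompletion K)} (hT : ∀ t ∈ T, ∀ t' ∈ T, t ≠ t' → -t + t' ∉ U)
    (hcov : C ⊆ ⋃ t ∈ T, (t +ᵥ (U : Set (ι → v.adicCompletion K))))
    (a : ι → v.adicCompletion K) (y : trivialAt K ι v) :
    Φ (placeSplitting K ι v (a, y)) =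
      ∑ t ∈ T, (t +ᵥ (U : Set (ι → v.adicCompletion K))).indicator (fun _ => (1 : R)) a *
        Φ (placeSplitting K ι v (t, y)) := by
  classical
  by_cases ha : ∃ t ∈ T, a ∈ t +ᵥ (U : Set (ι → v.adicCompletion K))
  · obtain ⟨t₀, ht₀, hat₀⟩ := ha
    -- only the `t₀`-term survives
    rw [Finset.sum_eq_single t₀]
    · rw [indicator_of_mem hat₀, one_mul]
      obtain ⟨c, hc, rfl⟩ := mem_vadd_set.1 hat₀
      rw [vadd_eq_add, placeSplitting_add_fst, hlev _ c hc]
    · intro t ht hne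
      rw [indicator_of_notMem, zero_mul]
      intro hat
      obtain ⟨c, hc, hca⟩ := mem_vadd_set.1 hat
      obtain ⟨c₀, hc₀, hc₀a⟩ := mem_vadd_set.1 hat₀
      refine hT t₀ ht₀ t ht (Ne.symm hne) ?_
      have h : -t₀ + t = c₀ - c := by
        rw [vadd_eq_add] at hca hc₀a
        rw [neg_add_eq_sub, sub_eq_sub_iff_add_eq_add, hca.trans hc₀a.symm, add_comm]
      rw [h]
      exact sub_mem hc₀ hc
    · exact fun h => (h ht₀).elim
  · -- no coset contains `a`: both sides vanish
    push Not at ha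
    have hzero : Φ (placeSplitting K ι v (a, y)) = 0 := by
      by_contra hne
      have hmem := hcov (hC _ hne)
      rw [evalAt_placeSplitting] at hmem
      obtain ⟨t, ht, hat⟩ := mem_iUnion₂.1 hmem
      exact ha t ht hat
    rw [hzero, eq_comm]
    exact Finset.sum_eq_zero fun t ht => by rw [indicator_of_notMem (ha t ht), zero_mul]

omit [Fintype ι] in
/-- The same sum formula read on `X(𝔸_K)` itself: `Φ(x) = Σ_{t ∈ T} 𝟙_{t + U}(x_v) · Φ(single t + x^{(v)})`.
[cite: WeilBNT1967, Ch. VII §2 Def. 1] -/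
theorem eq_sum_indicator_evalAt_mul_of_level {R : Type*} [NonAssocSemiring R] {Φ : (ι → AdeleRing (𝓞 K) K) → R}
    {U : AddSubgroup (ι → v.adicCompletion K)} (hlev : ∀ x, ∀ c ∈ U, Φ (x + single K ι v c) = Φ x)
    {C : Set (ι → v.adicCompletion K)} (hC : ∀ x, Φ x ≠ 0 → evalAt K ι v x ∈ C)
    {T : Finset (ι → v.adicCompletion K)} (hT : ∀ t ∈ T, ∀ t' ∈ T, t ≠ t' → -t + t' ∉ U)
    (hcov : C ⊆ ⋃ t ∈ T, (t +ᵥ (U : Set (ι → v.adicCompletion K)))) (x : ι → AdeleRing (𝓞 K) K) :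
    Φ x = ∑ t ∈ T, (t +ᵥ (U : Set (ι → v.adicCompletion K))).indicator (fun _ => (1 : R)) (evalAt K ι v x) *
        Φ (placeSplitting K ι v (t, ((placeSplitting K ι v).symm x).2)) := by
  have h := eq_sum_indicator_mul_of_level hlev hC hT hcov ((placeSplitting K ι v).symm x).1
    ((placeSplitting K ι v).symm x).2
  rwa [Prod.mk.eta, ContinuousAddEquiv.apply_symm_apply, placeSplitting_symm_apply_fst] at h

/-- **PURE-TENSOR DECOMPOSITION AT ONE FINITE PLACE** [WeilBNT1967, Ch. VII §2; Weil1965 n° 50]: for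
`Φ ∈ 𝒮(X(𝔸_K))` there are a compact open subgroup `U ≤ X(K_v)` (a level of `Φ` at `v`) and finitely many pairwise
`U`-inequivalent `t ∈ T ⊆ X(K_v)` with, for all `a ∈ X(K_v)` and `y ∈ X(𝔸_K)^{(v)}`,
`Φ (placeSplitting (a, y)) = Σ_{t ∈ T} 𝟙_{t + U}(a) · Φ (placeSplitting (t, y))` — `Φ ∘ placeSplitting` is the finite
sum of the pure tensors `𝟙_{t + U} ⊗ Φ(single t + ·)`. [cite: WeilBNT1967, Ch. VII §2 Def. 1] [cite: Weil1965, Chap. V n° 50, p. 74] -/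
theorem exists_sum_indicator_mul_slice (v : HeightOneSpectrum (𝓞 K)) {Φ : (ι → AdeleRing (𝓞 K) K) → ℂ}
    (hΦ : Φ ∈ piSchwartzBruhat K ι) :
    ∃ (U : AddSubgroup (ι → v.adicCompletion K)) (T : Finset (ι → v.adicCompletion K)),
      IsOpen (U : Set (ι → v.adicCompletion K)) ∧ IsCompact (U : Set (ι → v.adicCompletion K)) ∧
      (∀ x, ∀ c ∈ U, Φ (x + single K ι v c) = Φ x) ∧
      (∀ t ∈ T, ∀ t' ∈ T, t ≠ t' → -t + t' ∉ U) ∧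
      (∀ (a : ι → v.adicCompletion K) (y : trivialAt K ι v), Φ (placeSplitting K ι v (a, y)) =
        ∑ t ∈ T, (t +ᵥ (U : Set (ι → v.adicCompletion K))).indicator (fun _ => (1 : ℂ)) a *
          Φ (placeSplitting K ι v (t, y))) ∧
      ∀ x : ι → AdeleRing (𝓞 K) K, Φ x =
        ∑ t ∈ T, (t +ᵥ (U : Set (ι → v.adicCompletion K))).indicator (fun _ => (1 : ℂ)) (evalAt K ι v x) *
          Φ (placeSplitting K ι v (t, ((placeSplitting K ι v).symm x).2)) := by
  obtain ⟨U, hUo, hUc, hlev⟩ := exists_level_at v hΦ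
  obtain ⟨C, hC, hsupp⟩ := exists_isCompact_evalAt_mem v hΦ
  obtain ⟨T, hT, hcov⟩ := exists_finset_repr_cover U hUo hC
  exact ⟨U, T, hUo, hUc, hlev, hT, eq_sum_indicator_mul_of_level hlev hsupp hT hcov,
    eq_sum_indicator_evalAt_mul_of_level hlev hsupp hT hcov⟩

/-- **PURE-TENSOR DECOMPOSITION AT ONE FINITE PLACE, REAL FORM**: the same for `Ψ ∈ 𝒮_ℝ(X(𝔸_K)) =
piSchwartzBruhatReal K ι`, with real coefficients. [cite: WeilBNT1967, Ch. VII §2 Def. 1] [cite: Weil1965, Chap. V n° 50, p. 74] -/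
theorem exists_sum_indicator_mul_slice_real (v : HeightOneSpectrum (𝓞 K)) {Ψ : (ι → AdeleRing (𝓞 K) K) → ℝ}
    (hΨ : Ψ ∈ piSchwartzBruhatReal K ι) :
    ∃ (U : AddSubgroup (ι → v.adicCompletion K)) (T : Finset (ι → v.adicCompletion K)),
      IsOpen (U : Set (ι → v.adicCompletion K)) ∧ IsCompact (U : Set (ι → v.adicCompletion K)) ∧
      (∀ x, ∀ c ∈ U, Ψ (x + single K ι v c) = Ψ x) ∧
      (∀ t ∈ T, ∀ t' ∈ T, t ≠ t' → -t + t' ∉ U) ∧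
      (∀ (a : ι → v.adicCompletion K) (y : trivialAt K ι v), Ψ (placeSplitting K ι v (a, y)) =
        ∑ t ∈ T, (t +ᵥ (U : Set (ι → v.adicCompletion K))).indicator (fun _ => (1 : ℝ)) a *
          Ψ (placeSplitting K ι v (t, y))) ∧
      ∀ x : ι → AdeleRing (𝓞 K) K, Ψ x =
        ∑ t ∈ T, (t +ᵥ (U : Set (ι → v.adicCompletion K))).indicator (fun _ => (1 : ℝ)) (evalAt K ι v x) *
          Ψ (placeSplitting K ι v (t, ((placeSplitting K ι v).symm x).2)) := by
  obtain ⟨U, hUo, hUc, hlev⟩ := exists_level_at_real v hΨ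
  obtain ⟨C, hC, hsupp⟩ := exists_isCompact_evalAt_mem v (mem_piSchwartzBruhatReal_iff.1 hΨ)
  obtain ⟨T, hT, hcov⟩ := exists_finset_repr_cover U hUo hC
  have hsupp' : ∀ x, Ψ x ≠ 0 → evalAt K ι v x ∈ C := fun x hx => hsupp x (by exact_mod_cast hx)
  exact ⟨U, T, hUo, hUc, hlev, hT, eq_sum_indicator_mul_of_level hlev hsupp' hT hcov,
    eq_sum_indicator_evalAt_mul_of_level hlev hsupp' hT hcov⟩

end AdelicVector

end Literature.NumberTheory.Automorphic

end
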